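import Literature.MathematicalPhysics.QuantumFieldTheory.BalabanImbrieJaffe1984to88.BIJ85Prop12BridgeSup

/-!
# `BalabanImbrieJaffe1984to88.BIJ85Prop12BridgeHolder` — [BalabanImbrieJaffe1985] Sect. 7.2 p. 325 *"a consequence of Proposition 1.2 … of
[6I]"*, with [6I] = [Balaban1984PropagatorsI] Prop. 1.2 (1.111) p. 35: file 3 of the Prop. 1.2 FAMILY BRIDGE (files 1–2
`…BIJ85Prop12BridgeGeometry`, `…BIJ85Prop12BridgeSup`): THE HÖLDER MEMBER (1.111), `‖ζ∇GJ‖_α`.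

statement-level skeleton of published theorems with citation tags; proofs where landed; nothing here is a claim about the Yang–Mills mass gap

CITATION HEADER (lean-in-tree rule).  Part of the lit-balaban TYPED SKELETON (HOME `run/shared/lean/pub/lit-balaban/`), Phase-2 proof seat p19
gen 6; rows B5.Prop1.2 (proved, owner r02) → C1.Eq7.2.1-7.2.2 / C1.Eq7.2.4 / C2.Eq2.16–2.19 (fold owner r15 free target HOME/STATUS
2026-08-21T20:16:20Z).

THE PRINTED TEXT (verbatim, [6I] p. 35 [PDF 19]): *"‖A‖_α = max_μ sup_{x,x′:|x−x′|≤1} |x−x′|^{−α}|A_μ(x) − A_μ(x′)| … (1.109) …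
‖ζ∇GJ‖_α, ‖ζG∇*J‖_α ≤ O(1)e^{−δ₀|y−y′|}(‖ζ‖_α + |ζ|)|J| (1.111) for 0 ≤ α < 1, ζ ∈ C₀^∞(Δ̃(y)), supp J ⊂ Δ̃(y′), with the constant O(1)
depending on d and α (O(1) → ∞ if α → 1)"*.

WHAT IS PROVED (`n = L^k`, `M = Mk P k`, `R = torusRep P k (deltaAData hk a)`).  The first (1.111) entry of p09's carrier `settingOf R ·`,
`holderG R α (ζ·∇G_kJ) ≤ O(1)′(α)e^{−δ₀|y−y′|}(‖ζ‖_α + |ζ|)|J|` for `supp ζ ⊂ Δ̃(y)`, `supp J ⊂ Δ̃(y′)` (p09's CENTRED cubes), FROM the (1.110)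
entry `m = 1` and the (1.111) vector entry of the product setting `latticeSettingP12R n M a ·` at constants `(C, Cα, δ₀)` (hypotheses `hE1`,
`hH1` in r02's field notation; `hH1` for real vector sources `LocR.vec`) — **`holderG_smulG_le`**, with `O(1)′(α) = 3^d e^{5δ₀}(9·O(1) + max(O(1)(α),0)·(Lθ(d) + 1))`.  The route is
the one of p09's `BIJ85Ineq722ProofPart2` §3 for (7.2.2): a pair `x, x′` at distance `≤ ¼` unit is covered by r02's plateau cut-off
`cutP (nearOf (EK x′))` (= 1 at both points, `‖·‖_α + |·| ≤ Lθ(d) + 1`, supported in ONE product cube), to which the product (1.111) applies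
piece by block piece; a pair at distance `> ¼` is handled by the sup member (1.110) twice; the factor `ζ` is split off by
`|ζ(x)F(x) − ζ(x′)F(x′)| ≤ |ζ(x) − ζ(x′)||F(x)| + |ζ(x′)||F(x) − F(x′)|` (`abs_sub_le_holderS_mul`).  No partition of unity is needed, so the
two cube conventions never have to be matched.
HONEST SCOPE.  A transport of PROVED statements between two encodings of the same torus; constants change as displayed, absorbed by the
`∃ O(1)(α)` of `B5.Prop12Printed`.  No Prop-valued definition, no new hypothesis bundle.  Unit `lit-balaban-p19`
(literature-prover-lit-balaban-p19-g6-0), 2026-08-21.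
-/

namespace Literature.MathematicalPhysics.QuantumFieldTheory.BalabanImbrieJaffe1984to88.BIJ85Prop12BridgeHolder

open Literature.MathematicalPhysics.QuantumFieldTheory.Balaban1983to89
open scoped BigOperators Matrix
open LatticeFieldCalculus (supDist)
open B3TorusRadialSums (supDist_comm)
open B5Eq118OneStroke (iterBlockOf)
open B5Prop11Plancherel (Tor fine unitVec)
open B5Prop11Lattice (grad)
open B5Prop11SettingModel (Loc189)
open B5DeltaA169 (DeltaA)
open B5Eq117TorusCarriers (Mk EK)
open B5Prop12FieldsLattice (distU distSite toFine cubeT cubeB suppInL supNormL eL h1L cutInL cutHL holderT smulT)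
open B5SettingP12Real (LocR)
open B5CoverP12Lattice (cutP nearOf Lθ cutInL_cutP cutP_nearOf_eq_one_of_distU_le cutP_nearOf_eq_one mem_cubeT_nearOf distU_comm)
open LatticeNorms (supNorm norm_le_supNorm supNorm_le supNorm_nonneg holder_bound holderSeminorm_nonneg)
open BIJ85Ineq722Proof (Rep103)
open BIJ85Ineq722ProofPart2 (holderS holderG smulG)
open BIJ85Ineq722Torus (torusRep TorusData ctr supDist_triangle)
open BIJ85Ineq722DeltaA (Gk DGk deltaAData)
open BIJ85Prop12BridgeGeometry BIJ85Prop12BridgeSup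

noncomputable section

variable {P : Params} {k : ℕ}

/-! ## §1  The Hölder quotient of the cut-off and elementary `rpow` facts -/

/-- **`|ζ(x) − ζ(x′)| ≤ ‖ζ‖_α |x − x′|^α`** for `0 < |x − x′| ≤ 1`, from p09's Hölder functional `holderS` of the carrier.
[cite: Balaban1984PropagatorsI, (1.109) p.35] -/
theorem abs_sub_le_holderS_mul (R : Rep103) (α : ℝ) (ζ : R.S → ℝ) {x x' : R.S} (hpos : 0 < R.dS x x') (hle : R.dS x x' ≤ 1) :
    |ζ x - ζ x'| ≤ holderS R α ζ * R.dS x x' ^ α := by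
  have hD : 0 < R.dS x x' ^ α := Real.rpow_pos_of_pos hpos α
  have h := norm_le_pi_norm
    (fun p : R.S × R.S => if 0 < R.dS p.1 p.2 ∧ R.dS p.1 p.2 ≤ 1 then |ζ p.1 - ζ p.2| / R.dS p.1 p.2 ^ α else 0) (x, x')
  dsimp only at h
  rw [if_pos ⟨hpos, hle⟩, Real.norm_eq_abs, abs_div, abs_abs, abs_of_pos hD, div_le_iff₀ hD] at h
  exact h

/-- `¼ < t ≤ 1`, `0 ≤ α < 1 ⇒ 1 ≤ 4t^α`. [folklore] -/
private theorem one_le_four_mul_rpow {t α : ℝ} (ht : 1 / 4 < t) (ht1 : t ≤ 1) (hα0 : 0 ≤ α) (hα1 : α < 1) : 1 ≤ 4 * t ^ α := by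
  have ht0 : 0 < t := by linarith
  have h1 : t ≤ t ^ α := by
    have := Real.rpow_le_rpow_of_exponent_ge ht0 ht1 hα1.le
    rwa [Real.rpow_one] at this
  have _ := hα0
  linarith

/-! ## §2  The difference `|F(x) − F(x′)|` of `F = ∇G_kJ` for close pairs, through the product (1.111) with r02's plateau cut-off -/

section Close

variable (hk : k ≤ P.m + P.K) (a : ℝ) {C δ₀ : ℝ} {Cα : ℝ → ℝ}

/-- `1 ≤ L^k`. [folklore] -/
private theorem one_le_n (P : Params) (k : ℕ) : 1 ≤ P.L ^ k := Nat.one_le_pow _ _ P.L_pos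

/-- one block piece of the difference for a close pair: with `χ = cutP (nearOf (EK x′))` (`χ(EK x) = χ(EK x′) = 1`),
`|(χ∇G_kJ″^c)_λμ(EK x) − (χ∇G_kJ″^c)_λμ(EK x′)| ≤ ‖χ∇G_kJ″^c‖_α · |x − x′|^α` and the product (1.111) for the piece `J″ = J1_{Δ(y″)}`.
[cite: Balaban1984PropagatorsI, Prop. 1.2 (1.111) p.35] -/
theorem norm_grad_piece_sub_le {α : ℝ} (hα0 : 0 ≤ α) (hα1 : α < 1)
    (hH1 : ∀ (α : ℝ) (Jr : Tor (fine (P.L ^ k) (Mk P k)) × Fin P.d → ℝ) (ζ : Tor (fine (P.L ^ k) (Mk P k)) → ℝ)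
      (y y' : Tor (Mk P k)), 0 ≤ α → α < 1 →
      cutInL (P.L ^ k) (Mk P k) ζ y → suppInL (P.L ^ k) (Mk P k) (LocR.vec Jr : LocR (P.L ^ k) (Mk P k)).emb y' →
      h1L (P.L ^ k) (Mk P k) a (LocR.vec Jr : LocR (P.L ^ k) (Mk P k)).emb α ζ
        ≤ Cα α * Real.exp (-(δ₀ * distSite (Mk P k) y y')) * cutHL (P.L ^ k) (Mk P k) α ζ
          * supNormL (P.L ^ k) (Mk P k) (LocR.vec Jr : LocR (P.L ^ k) (Mk P k)).emb)
    (J : Balaban1983to89.Site P 0 × Fin P.d → ℝ) (y'' : Balaban1983to89.Site P k) {x x' : Balaban1983to89.Site P 0}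
    (hpos : 0 < distU (P.L ^ k) (Mk P k) (EK hk x) (EK hk x')) (hclose : distU (P.L ^ k) (Mk P k) (EK hk x) (EK hk x') ≤ 1 / 4)
    (lam μ : Fin P.d) :
    ‖grad (P.L ^ k) (Mk P k) ((DeltaA (P.L ^ k) (Mk P k) a)⁻¹ *ᵥ srcC hk (blockPiece k J y'')) lam (EK hk x, μ)
        - grad (P.L ^ k) (Mk P k) ((DeltaA (P.L ^ k) (Mk P k) a)⁻¹ *ᵥ srcC hk (blockPiece k J y'')) lam (EK hk x', μ)‖
      ≤ max (Cα α) 0 * Real.exp (-(δ₀ * distSite (Mk P k) (nearOf (Mk P k) (P.L ^ k) (EK hk x')) y'')) * (Lθ P.d + 1) * ‖J‖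
          * distU (P.L ^ k) (Mk P k) (EK hk x) (EK hk x') ^ α := by
  set χ : Tor (fine (P.L ^ k) (Mk P k)) → ℝ := cutP (Mk P k) (P.L ^ k) (nearOf (Mk P k) (P.L ^ k) (EK hk x')) with hχ
  set F : Fin P.d → (Tor (fine (P.L ^ k) (Mk P k)) × Fin P.d → ℂ) :=
    grad (P.L ^ k) (Mk P k) ((DeltaA (P.L ^ k) (Mk P k) a)⁻¹ *ᵥ srcC hk (blockPiece k J y'')) with hF
  have hn1 : 1 ≤ P.L ^ k := one_le_n P k
  have hle1 : distU (P.L ^ k) (Mk P k) (EK hk x) (EK hk x') ≤ 1 := hclose.trans (by norm_num)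
  -- the plateau of the cut-off covers both points
  have hχx' : χ (EK hk x') = 1 := cutP_nearOf_eq_one (Mk P k) (P.L ^ k) hn1 (EK hk x')
  have hχx : χ (EK hk x) = 1 := by
    refine cutP_nearOf_eq_one_of_distU_le (Mk P k) (P.L ^ k) hn1 ?_
    rwa [distU_comm]
  -- the product Hölder bound for the cut field `χF` at the pair
  have hD : 0 < distU (P.L ^ k) (Mk P k) (EK hk x) (EK hk x') ^ α := Real.rpow_pos_of_pos hpos α
  have hpair := holder_bound (adm := fun p p' : Fin P.d × (Tor (fine (P.L ^ k) (Mk P k)) × Fin P.d) =>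
      (p.1 = p'.1 ∧ p.2.2 = p'.2.2) ∧ distU (P.L ^ k) (Mk P k) p.2.1 p'.2.1 ≤ 1)
    (dist := fun p p' : Fin P.d × (Tor (fine (P.L ^ k) (Mk P k)) × Fin P.d) => distU (P.L ^ k) (Mk P k) p.2.1 p'.2.1)
    (τ := fun _ _ => id) (S := Finset.univ) (α := α)
    (fun p : Fin P.d × (Tor (fine (P.L ^ k) (Mk P k)) × Fin P.d) => smulT (P.L ^ k) (Mk P k) χ F p.1 p.2)
    (x := (lam, (EK hk x, μ))) (x' := (lam, (EK hk x', μ))) (Finset.mem_univ _) (Finset.mem_univ _)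
    ⟨⟨rfl, rfl⟩, hle1⟩ hpos
  dsimp only [id] at hpair
  -- `hpair : ‖χ(EK x′)F(EK x′) − χ(EK x)F(EK x)‖ ≤ holderT α (χF) * distU^α`
  have hval : ‖F lam (EK hk x, μ) - F lam (EK hk x', μ)‖
      = ‖smulT (P.L ^ k) (Mk P k) χ F lam (EK hk x', μ) - smulT (P.L ^ k) (Mk P k) χ F lam (EK hk x, μ)‖ := by
    simp only [smulT, hχx, hχx', Complex.ofReal_one, one_mul]
    exact norm_sub_rev _ _
  rw [hval]
  refine hpair.trans ?_
  -- the Hölder seminorm is r02's `h1L` of the piece, bounded by the product (1.111)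
  have hH := hH1 α (fun b => blockPiece k J y'' ((EK hk).symm b.1, b.2)) χ (nearOf (Mk P k) (P.L ^ k) (EK hk x')) y'' hα0 hα1
    (cutInL_cutP (Mk P k) (P.L ^ k) hn1 _) (suppInL_srcR_blockPiece hk J y'')
  rw [show (LocR.vec fun b => blockPiece k J y'' ((EK hk).symm b.1, b.2) : LocR (P.L ^ k) (Mk P k)).emb
      = Loc189.vec (srcC hk (blockPiece k J y'')) from rfl, B5Prop12FieldsLattice.h1L_vec] at hH
  have hcut : cutHL (P.L ^ k) (Mk P k) α χ ≤ Lθ P.d + 1 := B5GlobCoverP12Lattice.cutH_le (Mk P k) (P.L ^ k) (two_le_Mk P k) α _ hα1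
  have hJ'' : supNormL (P.L ^ k) (Mk P k) (Loc189.vec (srcC hk (blockPiece k J y''))) ≤ ‖J‖ := by
    have := (supNormL_srcR_le hk (blockPiece k J y'')).trans (norm_blockPiece_le J y'')
    rwa [emb_srcR] at this
  have hE : 0 ≤ Real.exp (-(δ₀ * distSite (Mk P k) (nearOf (Mk P k) (P.L ^ k) (EK hk x')) y'')) := (Real.exp_pos _).le
  have hcut0 : 0 ≤ cutHL (P.L ^ k) (Mk P k) α χ := B5Prop12FieldsLattice.cutHL_nonneg α χ
  have hJ0 : 0 ≤ supNormL (P.L ^ k) (Mk P k) (Loc189.vec (srcC hk (blockPiece k J y''))) := B5Prop12FieldsLattice.supNormL_nonneg _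
  have hm : 0 ≤ max (Cα α) 0 := le_max_right _ _
  have hL0 : 0 ≤ Lθ P.d := B5CoverP12Lattice.Lθ_nonneg P.d
  have h2 : holderT (P.L ^ k) (Mk P k) α (smulT (P.L ^ k) (Mk P k) χ F)
      ≤ max (Cα α) 0 * Real.exp (-(δ₀ * distSite (Mk P k) (nearOf (Mk P k) (P.L ^ k) (EK hk x')) y'')) * (Lθ P.d + 1) * ‖J‖ :=
    calc holderT (P.L ^ k) (Mk P k) α (smulT (P.L ^ k) (Mk P k) χ F)
        ≤ Cα α * Real.exp (-(δ₀ * distSite (Mk P k) (nearOf (Mk P k) (P.L ^ k) (EK hk x')) y''))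
            * cutHL (P.L ^ k) (Mk P k) α χ * supNormL (P.L ^ k) (Mk P k) (Loc189.vec (srcC hk (blockPiece k J y''))) := hH
      _ ≤ max (Cα α) 0 * Real.exp (-(δ₀ * distSite (Mk P k) (nearOf (Mk P k) (P.L ^ k) (EK hk x')) y''))
            * cutHL (P.L ^ k) (Mk P k) α χ * supNormL (P.L ^ k) (Mk P k) (Loc189.vec (srcC hk (blockPiece k J y''))) := by
          have h0 : 0 ≤ Real.exp (-(δ₀ * distSite (Mk P k) (nearOf (Mk P k) (P.L ^ k) (EK hk x')) y''))
              * cutHL (P.L ^ k) (Mk P k) α χ * supNormL (P.L ^ k) (Mk P k) (Loc189.vec (srcC hk (blockPiece k J y''))) := by positivity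
          have e1 : ∀ c : ℝ, c * Real.exp (-(δ₀ * distSite (Mk P k) (nearOf (Mk P k) (P.L ^ k) (EK hk x')) y''))
              * cutHL (P.L ^ k) (Mk P k) α χ * supNormL (P.L ^ k) (Mk P k) (Loc189.vec (srcC hk (blockPiece k J y'')))
              = c * (Real.exp (-(δ₀ * distSite (Mk P k) (nearOf (Mk P k) (P.L ^ k) (EK hk x')) y''))
              * cutHL (P.L ^ k) (Mk P k) α χ * supNormL (P.L ^ k) (Mk P k) (Loc189.vec (srcC hk (blockPiece k J y'')))) := fun c => by ring
          rw [e1, e1]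
          exact mul_le_mul_of_nonneg_right (le_max_left _ _) h0
      _ ≤ max (Cα α) 0 * Real.exp (-(δ₀ * distSite (Mk P k) (nearOf (Mk P k) (P.L ^ k) (EK hk x')) y'')) * (Lθ P.d + 1) * ‖J‖ :=
          mul_le_mul (mul_le_mul_of_nonneg_left hcut (mul_nonneg hm hE)) hJ'' hJ0 (by positivity)
  exact mul_le_mul_of_nonneg_right h2 hD.le

/-- **THE DIFFERENCE OF `∇G_kJ` AT A CLOSE PAIR**: for `0 < |x − x′| ≤ ¼` (unit of `T₁^{(k)}`) and `supp J ⊂ Δ̃(y′)` (p09's centred cube),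
`|(∇_λG_kJ)_μ(x) − (∇_λG_kJ)_μ(x′)| ≤ 3^d·max(O(1)(α),0)·(Lθ(d)+1)·e^{5δ₀}e^{−δ₀|x′_k − y′|}|J|·|x − x′|^α` (block split, the product (1.111)
with the plateau cut-off, `|ỹ − y″| ≥ |x′_k − y′| − 4` for `ỹ = nearOf (EK x′)`). [cite: Balaban1984PropagatorsI, Prop. 1.2 (1.111) p.35] -/
theorem abs_DGk_sub_le_close (hδ : 0 ≤ δ₀) {α : ℝ} (hα0 : 0 ≤ α) (hα1 : α < 1)
    (hH1 : ∀ (α : ℝ) (Jr : Tor (fine (P.L ^ k) (Mk P k)) × Fin P.d → ℝ) (ζ : Tor (fine (P.L ^ k) (Mk P k)) → ℝ)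
      (y y' : Tor (Mk P k)), 0 ≤ α → α < 1 →
      cutInL (P.L ^ k) (Mk P k) ζ y → suppInL (P.L ^ k) (Mk P k) (LocR.vec Jr : LocR (P.L ^ k) (Mk P k)).emb y' →
      h1L (P.L ^ k) (Mk P k) a (LocR.vec Jr : LocR (P.L ^ k) (Mk P k)).emb α ζ
        ≤ Cα α * Real.exp (-(δ₀ * distSite (Mk P k) y y')) * cutHL (P.L ^ k) (Mk P k) α ζ
          * supNormL (P.L ^ k) (Mk P k) (LocR.vec Jr : LocR (P.L ^ k) (Mk P k)).emb)
    {J : Balaban1983to89.Site P 0 × Fin P.d → ℝ} {y' : Balaban1983to89.Site P k}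
    (hJ : ∀ i, J i ≠ 0 → supDist i.1 (ctr k y') < P.L ^ k) {x x' : Balaban1983to89.Site P 0}
    (hpos : 0 < distU (P.L ^ k) (Mk P k) (EK hk x) (EK hk x')) (hclose : distU (P.L ^ k) (Mk P k) (EK hk x) (EK hk x') ≤ 1 / 4)
    (lam μ : Fin P.d) :
    |(DGk hk a *ᵥ J) (x, lam, μ) - (DGk hk a *ᵥ J) (x', lam, μ)|
      ≤ 3 ^ P.d * (max (Cα α) 0 * (Lθ P.d + 1) * Real.exp (4 * δ₀) * Real.exp (-(δ₀ * supDist (iterBlockOf k x') y')) * ‖J‖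
          * distU (P.L ^ k) (Mk P k) (EK hk x) (EK hk x') ^ α) := by
  classical
  have hn1 : 1 ≤ P.L ^ k := one_le_n P k
  -- block split of both values
  have hsplit : ∀ z : Balaban1983to89.Site P 0,
      (DGk hk a *ᵥ J) (z, lam, μ) = ∑ y'', (DGk hk a *ᵥ blockPiece k J y'') (z, lam, μ) := by
    intro z
    conv_lhs => rw [← sum_blockPiece (k := k) J]
    rw [Matrix.mulVec_sum, Finset.sum_apply]
  rw [hsplit x, hsplit x', ← Finset.sum_sub_distrib]
  have hL0 : 0 ≤ Lθ P.d := B5CoverP12Lattice.Lθ_nonneg P.d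
  have hm0 : 0 ≤ max (Cα α) 0 := le_max_right _ _
  have hD0 : 0 ≤ distU (P.L ^ k) (Mk P k) (EK hk x) (EK hk x') ^ α := (Real.rpow_pos_of_pos hpos α).le
  refine (Finset.abs_sum_le_sum_abs _ _).trans (sum_ball_le y' (by positivity) _ fun y'' => ?_)
  split_ifs with hnear
  · rw [DGk_mulVec_apply, DGk_mulVec_apply, ← Complex.sub_re]
    refine (Complex.abs_re_le_norm _).trans ((norm_grad_piece_sub_le hk a hα0 hα1 hH1 J y'' hpos hclose lam μ).trans ?_)
    -- the decay factor: `|ỹ − y″| ≥ |x′_k − y′| − 4`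
    have hyn : distSite (Mk P k) (iterBlockOf k x') (nearOf (Mk P k) (P.L ^ k) (EK hk x')) ≤ 3 :=
      distSite_le_three_of_mem_mem hn1 (EK_mem_cubeT_blk hk x') (mem_cubeT_nearOf (Mk P k) (P.L ^ k) hn1 (EK hk x'))
    have hexp : Real.exp (-(δ₀ * distSite (Mk P k) (nearOf (Mk P k) (P.L ^ k) (EK hk x')) y''))
        ≤ Real.exp (4 * δ₀) * Real.exp (-(δ₀ * supDist (iterBlockOf k x') y')) := by
      rw [← Real.exp_add]
      apply Real.exp_le_exp.mpr
      have h1 := B5RowSumsP12Lattice.distSite_triangle (Mk P k) (iterBlockOf k x') (nearOf (Mk P k) (P.L ^ k) (EK hk x')) y''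
      have h2 := supDist_triangle (iterBlockOf k x') y'' y'
      have h3 : (supDist (iterBlockOf k x') y' : ℝ) ≤ supDist (iterBlockOf k x') y'' + 1 := by
        exact_mod_cast h2.trans (Nat.add_le_add_left hnear _)
      rw [← supDist_cast_eq_distSite (iterBlockOf k x') y''] at h1
      nlinarith
    have hD : 0 ≤ distU (P.L ^ k) (Mk P k) (EK hk x) (EK hk x') ^ α := (Real.rpow_pos_of_pos hpos α).le
    have hm : 0 ≤ max (Cα α) 0 := le_max_right _ _
    have hL : 0 ≤ Lθ P.d + 1 := by have := B5CoverP12Lattice.Lθ_nonneg P.d; positivity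
    calc max (Cα α) 0 * Real.exp (-(δ₀ * distSite (Mk P k) (nearOf (Mk P k) (P.L ^ k) (EK hk x')) y'')) * (Lθ P.d + 1) * ‖J‖
          * distU (P.L ^ k) (Mk P k) (EK hk x) (EK hk x') ^ α
        ≤ max (Cα α) 0 * (Real.exp (4 * δ₀) * Real.exp (-(δ₀ * supDist (iterBlockOf k x') y'))) * (Lθ P.d + 1) * ‖J‖
          * distU (P.L ^ k) (Mk P k) (EK hk x) (EK hk x') ^ α := by gcongr
      _ = _ := by ring
  · rw [blockPiece_eq_zero_of_far hk hJ hnear, Matrix.mulVec_zero, Pi.zero_apply, Pi.zero_apply, sub_zero, abs_zero]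

end Close

/-! ## §3  The Hölder member (1.111) of p09's carrier -/

section Holder

variable (hk : k ≤ P.m + P.K) (a : ℝ) {C δ₀ : ℝ} {Cα : ℝ → ℝ}

/-- **THE (1.111) CONSTANT OF THE BRIDGE**: `O(1)′(α) = 3^d e^{5δ₀}(9·O(1) + max(O(1)(α), 0)·(Lθ(d) + 1))`.
[cite: Balaban1984PropagatorsI, Prop. 1.2 (1.111) p.35 («the constant O(1) depending on d and α»)] -/
def holderConst (d : ℕ) (C δ₀ : ℝ) (Cα : ℝ → ℝ) (α : ℝ) : ℝ :=
  3 ^ d * Real.exp (5 * δ₀) * (9 * C + max (Cα α) 0 * (Lθ d + 1))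

/-- `0 ≤ O(1)′(α)` for `O(1) ≥ 0`. [cite: Balaban1984PropagatorsI, Prop. 1.2 (1.111) p.35] -/
theorem holderConst_nonneg (d : ℕ) {C : ℝ} (hC : 0 ≤ C) (δ₀ : ℝ) (Cα : ℝ → ℝ) (α : ℝ) : 0 ≤ holderConst d C δ₀ Cα α := by
  unfold holderConst
  have := B5CoverP12Lattice.Lθ_nonneg d
  have := le_max_right (Cα α) 0
  positivity

/-- **THE POINTWISE ESTIMATE BEHIND (1.111) FOR p09's CARRIER**: for `supp ζ ⊂ Δ̃(y)`, `supp J ⊂ Δ̃(y′)` (centred cubes) and a pair `x, x′`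
with `0 < t = |x − x′| ≤ 1`, same component `(λ, μ)`:
`|ζ(x)(∇_λG_kJ)_μ(x) − ζ(x′)(∇_λG_kJ)_μ(x′)| ≤ O(1)′(α)e^{−δ₀|y−y′|}(‖ζ‖_α + |ζ|)|J|·t^α`.
[cite: Balaban1984PropagatorsI, Prop. 1.2 (1.111) p.35] -/
theorem abs_smul_sub_le (hC : 0 ≤ C) (hδ : 0 ≤ δ₀) {α : ℝ} (hα0 : 0 ≤ α) (hα1 : α < 1)
    (hE1 : ∀ (J : LocR (P.L ^ k) (Mk P k)) (y y' : Tor (Mk P k)), suppInL (P.L ^ k) (Mk P k) J.emb y' →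
      eL (P.L ^ k) (Mk P k) a 1 J.emb y ≤ C * Real.exp (-(δ₀ * distSite (Mk P k) y y')) * supNormL (P.L ^ k) (Mk P k) J.emb)
    (hH1 : ∀ (α : ℝ) (Jr : Tor (fine (P.L ^ k) (Mk P k)) × Fin P.d → ℝ) (ζ : Tor (fine (P.L ^ k) (Mk P k)) → ℝ)
      (y y' : Tor (Mk P k)), 0 ≤ α → α < 1 →
      cutInL (P.L ^ k) (Mk P k) ζ y → suppInL (P.L ^ k) (Mk P k) (LocR.vec Jr : LocR (P.L ^ k) (Mk P k)).emb y' →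
      h1L (P.L ^ k) (Mk P k) a (LocR.vec Jr : LocR (P.L ^ k) (Mk P k)).emb α ζ
        ≤ Cα α * Real.exp (-(δ₀ * distSite (Mk P k) y y')) * cutHL (P.L ^ k) (Mk P k) α ζ
          * supNormL (P.L ^ k) (Mk P k) (LocR.vec Jr : LocR (P.L ^ k) (Mk P k)).emb)
    {J : Balaban1983to89.Site P 0 × Fin P.d → ℝ} {ζ : Balaban1983to89.Site P 0 → ℝ} {y y' : Balaban1983to89.Site P k}
    (hζ : ∀ z, ζ z ≠ 0 → supDist z (ctr k y) < P.L ^ k) (hJ : ∀ i, J i ≠ 0 → supDist i.1 (ctr k y') < P.L ^ k)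
    {x x' : Balaban1983to89.Site P 0} {t : ℝ} (ht : distU (P.L ^ k) (Mk P k) (EK hk x) (EK hk x') = t)
    (hpos : 0 < t) (hle : t ≤ 1) (lam μ : Fin P.d) :
    |ζ x * (DGk hk a *ᵥ J) (x, lam, μ) - ζ x' * (DGk hk a *ᵥ J) (x', lam, μ)|
      ≤ holderConst P.d C δ₀ Cα α * Real.exp (-(δ₀ * supDist y y'))
          * (holderS (torusRep P k (deltaAData hk a)) α ζ + ‖ζ‖) * ‖J‖ * t ^ α := by
  have hdS : (torusRep P k (deltaAData hk a)).dS x x' = t := by rw [← distU_EK_eq_dS hk]; exact ht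
  have htα : 0 < t ^ α := Real.rpow_pos_of_pos hpos α
  have hHS : 0 ≤ holderS (torusRep P k (deltaAData hk a)) α ζ := norm_nonneg _
  have hζn : |ζ x'| ≤ ‖ζ‖ := by rw [← Real.norm_eq_abs]; exact norm_le_pi_norm ζ x'
  have hL : 0 ≤ Lθ P.d := B5CoverP12Lattice.Lθ_nonneg P.d
  have hm : 0 ≤ max (Cα α) 0 := le_max_right _ _
  have hK0 : 0 ≤ holderConst P.d C δ₀ Cα α := holderConst_nonneg P.d hC δ₀ Cα α
  have he3 : 0 < Real.exp (3 * δ₀) := Real.exp_pos _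
  have he5 : 0 < Real.exp (5 * δ₀) := Real.exp_pos _
  have h35 : Real.exp (3 * δ₀) ≤ Real.exp (5 * δ₀) := Real.exp_le_exp.mpr (by nlinarith)
  -- trivial case: both cut-off values vanish
  by_cases h00 : ζ x = 0 ∧ ζ x' = 0
  · rw [h00.1, h00.2, zero_mul, zero_mul, sub_zero, abs_zero]
    positivity
  -- otherwise one of `x, x′` lies in `Δ̃(y)`, so both blocks are within two units of `y`
  have hxx' : supDist (iterBlockOf k x) (iterBlockOf k x') ≤ 1 :=
    supDist_blk_le_one_of_dS_le_one hk (deltaAData hk a) (by rw [hdS]; exact hle)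
  have key : ∀ w : Balaban1983to89.Site P 0, ζ w ≠ 0 → supDist y (iterBlockOf k w) ≤ 1 := fun w hw => by
    have h := supDist_blk_le_one_of_mem_cube hk (deltaAData hk a) ((mem_cube_iff_supDist_lt _ y w).mpr (hζ w hw))
    rwa [supDist_comm] at h
  have hbx : supDist y (iterBlockOf k x) ≤ 2 := by
    rcases not_and_or.mp h00 with h | h
    · exact (key x h).trans (by norm_num)
    · have h1 := key x' h
      have h2 := supDist_triangle y (iterBlockOf k x') (iterBlockOf k x)
      rw [supDist_comm (iterBlockOf k x')] at h2
      omega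
  have hbx' : supDist y (iterBlockOf k x') ≤ 2 := by
    rcases not_and_or.mp h00 with h | h
    · have h1 := key x h
      have h2 := supDist_triangle y (iterBlockOf k x) (iterBlockOf k x')
      omega
    · exact (key x' h).trans (by norm_num)
  -- the sup member at both points: `|F(z)| ≤ 3^d C e^{3δ₀} e^{−δ₀|y−y′|}|J|`
  have hF : ∀ z : Balaban1983to89.Site P 0, supDist y (iterBlockOf k z) ≤ 2 →
      |(DGk hk a *ᵥ J) (z, lam, μ)| ≤ 3 ^ P.d * C * Real.exp (3 * δ₀) * (Real.exp (-(δ₀ * supDist y y')) * ‖J‖) := by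
    intro z hz
    have h1 := abs_DGk_mulVec_le hk a hC hδ hE1 hJ z lam μ
    have h2 : Real.exp (-(δ₀ * supDist (iterBlockOf k z) y')) ≤ Real.exp (2 * δ₀) * Real.exp (-(δ₀ * supDist y y')) := by
      rw [← Real.exp_add]
      apply Real.exp_le_exp.mpr
      have h3 := supDist_triangle y (iterBlockOf k z) y'
      have h4 : (supDist y y' : ℝ) ≤ 2 + supDist (iterBlockOf k z) y' := by
        exact_mod_cast h3.trans (Nat.add_le_add_right hz _)
      nlinarith
    calc |(DGk hk a *ᵥ J) (z, lam, μ)| ≤ 3 ^ P.d * (C * Real.exp δ₀ * Real.exp (-(δ₀ * supDist (iterBlockOf k z) y')) * ‖J‖) := h1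
      _ ≤ 3 ^ P.d * (C * Real.exp δ₀ * (Real.exp (2 * δ₀) * Real.exp (-(δ₀ * supDist y y'))) * ‖J‖) := by gcongr
      _ = 3 ^ P.d * C * Real.exp (3 * δ₀) * (Real.exp (-(δ₀ * supDist y y')) * ‖J‖) := by
          rw [show (3 : ℝ) * δ₀ = δ₀ + 2 * δ₀ by ring, Real.exp_add]; ring
  have hFx := hF x hbx
  have hFx' := hF x' hbx'
  -- split off the cut-off
  have hsplit : |ζ x * (DGk hk a *ᵥ J) (x, lam, μ) - ζ x' * (DGk hk a *ᵥ J) (x', lam, μ)|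
      ≤ |ζ x - ζ x'| * |(DGk hk a *ᵥ J) (x, lam, μ)|
        + |ζ x'| * |(DGk hk a *ᵥ J) (x, lam, μ) - (DGk hk a *ᵥ J) (x', lam, μ)| := by
    have e : ζ x * (DGk hk a *ᵥ J) (x, lam, μ) - ζ x' * (DGk hk a *ᵥ J) (x', lam, μ)
        = (ζ x - ζ x') * (DGk hk a *ᵥ J) (x, lam, μ) + ζ x' * ((DGk hk a *ᵥ J) (x, lam, μ) - (DGk hk a *ᵥ J) (x', lam, μ)) := by
      ring
    rw [e, ← abs_mul, ← abs_mul]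
    exact abs_add_le _ _
  -- first term
  have hT1 : |ζ x - ζ x'| * |(DGk hk a *ᵥ J) (x, lam, μ)|
      ≤ (holderS (torusRep P k (deltaAData hk a)) α ζ * t ^ α)
        * (3 ^ P.d * C * Real.exp (3 * δ₀) * (Real.exp (-(δ₀ * supDist y y')) * ‖J‖)) := by
    have h := abs_sub_le_holderS_mul (torusRep P k (deltaAData hk a)) α ζ (x := x) (x' := x') (by rw [hdS]; exact hpos)
      (by rw [hdS]; exact hle)
    rw [hdS] at h
    exact mul_le_mul h hFx (abs_nonneg _) (mul_nonneg hHS htα.le)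
  -- second term: close pairs by §2, far pairs by the sup member twice
  have hT2 : |ζ x'| * |(DGk hk a *ᵥ J) (x, lam, μ) - (DGk hk a *ᵥ J) (x', lam, μ)|
      ≤ ‖ζ‖ * ((3 ^ P.d * (max (Cα α) 0 * (Lθ P.d + 1) * Real.exp (5 * δ₀) + 8 * C * Real.exp (3 * δ₀)))
        * (Real.exp (-(δ₀ * supDist y y')) * ‖J‖) * t ^ α) := by
    by_cases hx0' : ζ x' = 0
    · rw [hx0', abs_zero, zero_mul]
      positivity
    refine mul_le_mul hζn ?_ (abs_nonneg _) (norm_nonneg _)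
    by_cases hc : t ≤ 1 / 4
    · -- close pair
      have hposU : 0 < distU (P.L ^ k) (Mk P k) (EK hk x) (EK hk x') := by rw [ht]; exact hpos
      have hcloseU : distU (P.L ^ k) (Mk P k) (EK hk x) (EK hk x') ≤ 1 / 4 := by rw [ht]; exact hc
      have h1 := abs_DGk_sub_le_close hk a hδ hα0 hα1 hH1 hJ hposU hcloseU lam μ
      rw [ht] at h1
      have h2 : Real.exp (-(δ₀ * supDist (iterBlockOf k x') y')) ≤ Real.exp δ₀ * Real.exp (-(δ₀ * supDist y y')) := by
        rw [← Real.exp_add]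
        apply Real.exp_le_exp.mpr
        have h3 := key x' hx0'
        have h4 := supDist_triangle y (iterBlockOf k x') y'
        have h5 : (supDist y y' : ℝ) ≤ 1 + supDist (iterBlockOf k x') y' := by
          exact_mod_cast h4.trans (Nat.add_le_add_right h3 _)
        nlinarith
      calc |(DGk hk a *ᵥ J) (x, lam, μ) - (DGk hk a *ᵥ J) (x', lam, μ)|
          ≤ 3 ^ P.d * (max (Cα α) 0 * (Lθ P.d + 1) * Real.exp (4 * δ₀) * Real.exp (-(δ₀ * supDist (iterBlockOf k x') y')) * ‖J‖
              * t ^ α) := h1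
        _ ≤ 3 ^ P.d * (max (Cα α) 0 * (Lθ P.d + 1) * Real.exp (4 * δ₀) * (Real.exp δ₀ * Real.exp (-(δ₀ * supDist y y'))) * ‖J‖
              * t ^ α) := by gcongr
        _ = (3 ^ P.d * (max (Cα α) 0 * (Lθ P.d + 1) * Real.exp (5 * δ₀))) * (Real.exp (-(δ₀ * supDist y y')) * ‖J‖) * t ^ α := by
            rw [show (5 : ℝ) * δ₀ = 4 * δ₀ + δ₀ by ring, Real.exp_add (4 * δ₀)]; ring
        _ ≤ (3 ^ P.d * (max (Cα α) 0 * (Lθ P.d + 1) * Real.exp (5 * δ₀) + 8 * C * Real.exp (3 * δ₀)))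
              * (Real.exp (-(δ₀ * supDist y y')) * ‖J‖) * t ^ α := by
            gcongr
            have : 0 ≤ 8 * C * Real.exp (3 * δ₀) := by positivity
            linarith
    · -- far pair: `1 ≤ 4 t^α`
      rw [not_le] at hc
      have h4 : 1 ≤ 4 * t ^ α := one_le_four_mul_rpow hc hle hα0 hα1
      have hA : 0 ≤ 3 ^ P.d * C * Real.exp (3 * δ₀) * (Real.exp (-(δ₀ * supDist y y')) * ‖J‖) := by positivity
      calc |(DGk hk a *ᵥ J) (x, lam, μ) - (DGk hk a *ᵥ J) (x', lam, μ)|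
          ≤ |(DGk hk a *ᵥ J) (x, lam, μ)| + |(DGk hk a *ᵥ J) (x', lam, μ)| := abs_sub _ _
        _ ≤ 2 * (3 ^ P.d * C * Real.exp (3 * δ₀) * (Real.exp (-(δ₀ * supDist y y')) * ‖J‖)) * 1 := by linarith
        _ ≤ 2 * (3 ^ P.d * C * Real.exp (3 * δ₀) * (Real.exp (-(δ₀ * supDist y y')) * ‖J‖)) * (4 * t ^ α) :=
            mul_le_mul_of_nonneg_left h4 (by positivity)
        _ = (3 ^ P.d * (8 * C * Real.exp (3 * δ₀))) * (Real.exp (-(δ₀ * supDist y y')) * ‖J‖) * t ^ α := by ring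
        _ ≤ (3 ^ P.d * (max (Cα α) 0 * (Lθ P.d + 1) * Real.exp (5 * δ₀) + 8 * C * Real.exp (3 * δ₀)))
              * (Real.exp (-(δ₀ * supDist y y')) * ‖J‖) * t ^ α := by
            gcongr
            have : 0 ≤ max (Cα α) 0 * (Lθ P.d + 1) * Real.exp (5 * δ₀) := by positivity
            linarith
  -- assemble: both coefficients are below `holderConst`
  have hc1 : 3 ^ P.d * C * Real.exp (3 * δ₀) ≤ holderConst P.d C δ₀ Cα α := by
    unfold holderConst
    have h1 : C * Real.exp (3 * δ₀) ≤ C * Real.exp (5 * δ₀) := mul_le_mul_of_nonneg_left h35 hC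
    have h2 : C * Real.exp (5 * δ₀) ≤ Real.exp (5 * δ₀) * (9 * C + max (Cα α) 0 * (Lθ P.d + 1)) := by
      have : 0 ≤ max (Cα α) 0 * (Lθ P.d + 1) := by positivity
      nlinarith
    calc 3 ^ P.d * C * Real.exp (3 * δ₀) = 3 ^ P.d * (C * Real.exp (3 * δ₀)) := by ring
      _ ≤ 3 ^ P.d * (Real.exp (5 * δ₀) * (9 * C + max (Cα α) 0 * (Lθ P.d + 1))) :=
          mul_le_mul_of_nonneg_left (h1.trans h2) (by positivity)
      _ = _ := by ring
  have hc2 : 3 ^ P.d * (max (Cα α) 0 * (Lθ P.d + 1) * Real.exp (5 * δ₀) + 8 * C * Real.exp (3 * δ₀))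
      ≤ holderConst P.d C δ₀ Cα α := by
    unfold holderConst
    have h1 : 8 * C * Real.exp (3 * δ₀) ≤ 8 * C * Real.exp (5 * δ₀) := mul_le_mul_of_nonneg_left h35 (by positivity)
    have h2 : max (Cα α) 0 * (Lθ P.d + 1) * Real.exp (5 * δ₀) + 8 * C * Real.exp (5 * δ₀)
        ≤ Real.exp (5 * δ₀) * (9 * C + max (Cα α) 0 * (Lθ P.d + 1)) := by nlinarith
    calc 3 ^ P.d * (max (Cα α) 0 * (Lθ P.d + 1) * Real.exp (5 * δ₀) + 8 * C * Real.exp (3 * δ₀))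
        ≤ 3 ^ P.d * (Real.exp (5 * δ₀) * (9 * C + max (Cα α) 0 * (Lθ P.d + 1))) :=
          mul_le_mul_of_nonneg_left (by linarith) (by positivity)
      _ = _ := by ring
  have hX : 0 ≤ holderS (torusRep P k (deltaAData hk a)) α ζ * t ^ α * (Real.exp (-(δ₀ * supDist y y')) * ‖J‖) := by
    positivity
  have hY : 0 ≤ ‖ζ‖ * (Real.exp (-(δ₀ * supDist y y')) * ‖J‖) * t ^ α := by positivity
  calc |ζ x * (DGk hk a *ᵥ J) (x, lam, μ) - ζ x' * (DGk hk a *ᵥ J) (x', lam, μ)|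
      ≤ (holderS (torusRep P k (deltaAData hk a)) α ζ * t ^ α)
          * (3 ^ P.d * C * Real.exp (3 * δ₀) * (Real.exp (-(δ₀ * supDist y y')) * ‖J‖))
        + ‖ζ‖ * ((3 ^ P.d * (max (Cα α) 0 * (Lθ P.d + 1) * Real.exp (5 * δ₀) + 8 * C * Real.exp (3 * δ₀)))
          * (Real.exp (-(δ₀ * supDist y y')) * ‖J‖) * t ^ α) := hsplit.trans (add_le_add hT1 hT2)
    _ = (3 ^ P.d * C * Real.exp (3 * δ₀))
          * (holderS (torusRep P k (deltaAData hk a)) α ζ * t ^ α * (Real.exp (-(δ₀ * supDist y y')) * ‖J‖))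
        + (3 ^ P.d * (max (Cα α) 0 * (Lθ P.d + 1) * Real.exp (5 * δ₀) + 8 * C * Real.exp (3 * δ₀)))
          * (‖ζ‖ * (Real.exp (-(δ₀ * supDist y y')) * ‖J‖) * t ^ α) := by ring
    _ ≤ holderConst P.d C δ₀ Cα α
          * (holderS (torusRep P k (deltaAData hk a)) α ζ * t ^ α * (Real.exp (-(δ₀ * supDist y y')) * ‖J‖))
        + holderConst P.d C δ₀ Cα α * (‖ζ‖ * (Real.exp (-(δ₀ * supDist y y')) * ‖J‖) * t ^ α) :=
        add_le_add (mul_le_mul_of_nonneg_right hc1 hX) (mul_le_mul_of_nonneg_right hc2 hY)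
    _ = _ := by ring

/-- **(1.111), FIRST ENTRY, FOR p09's CARRIER**: `‖ζ∇G_kJ‖_α ≤ O(1)′(α)e^{−δ₀|y−y′|}(‖ζ‖_α + |ζ|)|J|` for `0 ≤ α < 1`, `supp ζ ⊂ Δ̃(y)`,
`supp J ⊂ Δ̃(y′)` (the centred cubes of `torusRep`), with p09's Hölder functionals `holderG`/`holderS` — from the (1.110) `m = 1` and
(1.111) vector entries of the product setting. [cite: Balaban1984PropagatorsI, Prop. 1.2 (1.111) p.35] -/
theorem holderG_smulG_le (hC : 0 ≤ C) (hδ : 0 ≤ δ₀) {α : ℝ} (hα0 : 0 ≤ α) (hα1 : α < 1)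
    (hE1 : ∀ (J : LocR (P.L ^ k) (Mk P k)) (y y' : Tor (Mk P k)), suppInL (P.L ^ k) (Mk P k) J.emb y' →
      eL (P.L ^ k) (Mk P k) a 1 J.emb y ≤ C * Real.exp (-(δ₀ * distSite (Mk P k) y y')) * supNormL (P.L ^ k) (Mk P k) J.emb)
    (hH1 : ∀ (α : ℝ) (Jr : Tor (fine (P.L ^ k) (Mk P k)) × Fin P.d → ℝ) (ζ : Tor (fine (P.L ^ k) (Mk P k)) → ℝ)
      (y y' : Tor (Mk P k)), 0 ≤ α → α < 1 →
      cutInL (P.L ^ k) (Mk P k) ζ y → suppInL (P.L ^ k) (Mk P k) (LocR.vec Jr : LocR (P.L ^ k) (Mk P k)).emb y' →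
      h1L (P.L ^ k) (Mk P k) a (LocR.vec Jr : LocR (P.L ^ k) (Mk P k)).emb α ζ
        ≤ Cα α * Real.exp (-(δ₀ * distSite (Mk P k) y y')) * cutHL (P.L ^ k) (Mk P k) α ζ
          * supNormL (P.L ^ k) (Mk P k) (LocR.vec Jr : LocR (P.L ^ k) (Mk P k)).emb)
    (J : Balaban1983to89.Site P 0 × Fin P.d → ℝ) (ζ : Balaban1983to89.Site P 0 → ℝ) (y y' : Balaban1983to89.Site P k)
    (hζ : ∀ z, ζ z ≠ 0 → supDist z (ctr k y) < P.L ^ k) (hJ : ∀ i, J i ≠ 0 → supDist i.1 (ctr k y') < P.L ^ k) :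
    holderG (torusRep P k (deltaAData hk a)) α (smulG (torusRep P k (deltaAData hk a)) ζ (DGk hk a *ᵥ J))
      ≤ holderConst P.d C δ₀ Cα α * Real.exp (-(δ₀ * supDist y y'))
          * (holderS (torusRep P k (deltaAData hk a)) α ζ + ‖ζ‖) * ‖J‖ := by
  set R := torusRep P k (deltaAData hk a) with hR
  have hHS : 0 ≤ holderS R α ζ := norm_nonneg _
  have hB : 0 ≤ holderConst P.d C δ₀ Cα α * Real.exp (-(δ₀ * supDist y y')) * (holderS R α ζ + ‖ζ‖) * ‖J‖ := by
    have := holderConst_nonneg P.d hC δ₀ Cα α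
    positivity
  refine (pi_norm_le_iff_of_nonneg hB).2 fun p => ?_
  obtain ⟨⟨x, lam, μ⟩, ⟨x', lam', μ'⟩⟩ := p
  dsimp only [smulG]
  split_ifs with hcond
  · obtain ⟨hcomp, hpos, hle⟩ := hcond
    obtain ⟨rfl, rfl⟩ := Prod.mk.inj hcomp
    have hD : 0 < R.dS x x' ^ α := Real.rpow_pos_of_pos hpos α
    rw [Real.norm_eq_abs, abs_div, abs_abs, abs_of_pos hD, div_le_iff₀ hD]
    exact abs_smul_sub_le hk a hC hδ hα0 hα1 hE1 hH1 hζ hJ (distU_EK_eq_dS hk (deltaAData hk a) x x') hpos hle lam μ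
  · rw [norm_zero]; exact hB

end Holder

end

end Literature.MathematicalPhysics.QuantumFieldTheory.BalabanImbrieJaffe1984to88.BIJ85Prop12BridgeHolder
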